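import Literature.NumberTheory.CubicFields.PureCubicEmbeddingValues
import Literature.Algebra.EuclideanLattices.SupNormCoNormFinThree
import HarnessLib

/-!
# The scaled embedding matrix of a lattice of a pure cubic field

Topic `NumberTheory/CubicFields`, sub-namespace `PureCubicLexMin`. The real `3 × 3` matrix
`B_X = embMatrix t₁ t₂ X den [h11, …, h33]` of `PureCubicLexMinProgram.lean` (rows: the scaled
embeddings `(σ₁ r / X, Re σ₂ r, ± Im σ₂ r)` of the basis rows `r` of the lattice code
`(den, [h11, h12, h13, h22, h23, h33])`). PROVED here:

* `embMatrix_eq_smul_mul` : `B_X = den⁻¹ • (H · M · diag(X⁻¹, 1, 1))` with `H` the upper triangular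
  coordinate matrix and `M = [[1, 1, 0], [t₁, −t₁/2, (√3/2)t₁], [t₂, −t₂/2, −(√3/2)t₂]]`,
  `det M = (3√3/2) t₁ t₂` (`det_embM`);
* `embMatrix_conorm` (**co-norm**): `min(X⁻¹, 1) / (18 (ab)² h² den) · ‖v‖ ≤ ‖v B_X‖` for all real
  rows `v` (sup norms), when `t₁ = ∛(ab²)`, `t₂ = ∛(a²b)`, `|hᵢⱼ| ≤ h` and the diagonal of `H` is
  `≥ 1` (from `conorm_of_abs_le`, `conorm_mul`, `conorm_diagonal` of `SupNormCoNormFinThree.lean`);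
* `cast_vecMul_embMatrix` : `c B_X = embRow (c H)` for integer rows `c`, and `norm_embRow_eq` :
  `‖embRow t₁ t₂ X den w‖ = max (|σ₁ φ| / X, |Re σ₂ φ|, |Im σ₂ φ|)` for `φ = lin w / den`
  (`sigma1_lin`, `exists_sign_sigma2_lin`).

## References

* H. Cohen, *A Course in Computational Algebraic Number Theory*, GTM 138 (1993), §6.5. [Cohen1993]
* J. Buchmann, J. Number Theory 26 (1987), §3. [folklore]
-/

noncomputable section

namespace Literature.NumberTheory.CubicFields

namespace PureCubicLexMin

open Matrix Literature.Algebra.EuclideanLattices PureCubicCodes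
open scoped NumberField ComplexConjugate

/-! ### The factorisation `B_X = den⁻¹ • H M D` -/

section Factor

variable (t₁ t₂ X : ℝ) (den : ℕ) (hs : List ℤ)

/-- **Entrywise factorisation** `B_X = den⁻¹ • (H · M · diag(X⁻¹, 1, 1))`. [cite: Cohen1993, §6.5] -/
theorem embMatrix_eq_smul_mul (hden : den ≠ 0) (hX : X ≠ 0) :
    embMatrix t₁ t₂ X den hs = (den : ℝ)⁻¹ •
      ((Matrix.of ![![(hs.getD 0 0 : ℝ), hs.getD 1 0, hs.getD 2 0], ![0, hs.getD 3 0, hs.getD 4 0],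
          ![0, 0, hs.getD 5 0]]) *
        (Matrix.of ![![1, 1, 0], ![t₁, -t₁ / 2, Real.sqrt 3 / 2 * t₁], ![t₂, -t₂ / 2, -(Real.sqrt 3 / 2 * t₂)]]) *
        Matrix.diagonal ![X⁻¹, 1, 1]) := by
  have hd : (den : ℝ) ≠ 0 := Nat.cast_ne_zero.2 hden
  ext i j
  rw [Matrix.smul_apply, Matrix.mul_apply, Fin.sum_univ_three]
  simp only [Matrix.mul_apply, Fin.sum_univ_three, Matrix.diagonal_apply, Matrix.of_apply]
  fin_cases i <;> fin_cases j <;> simp [embMatrix, embRow] <;> field_simp <;> ring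

/-- `det M = (3√3/2) t₁ t₂`. [folklore] -/
theorem det_embM : (Matrix.of ![![1, 1, 0], ![t₁, -t₁ / 2, Real.sqrt 3 / 2 * t₁],
    ![t₂, -t₂ / 2, -(Real.sqrt 3 / 2 * t₂)]] : Matrix (Fin 3) (Fin 3) ℝ).det = 3 * Real.sqrt 3 / 2 * t₁ * t₂ := by
  rw [Matrix.det_fin_three]
  simp
  ring

/-- `det H = h11 h22 h33`. [folklore] -/
theorem det_embH : (Matrix.of ![![(hs.getD 0 0 : ℝ), hs.getD 1 0, hs.getD 2 0], ![0, hs.getD 3 0, hs.getD 4 0],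
    ![0, 0, hs.getD 5 0]] : Matrix (Fin 3) (Fin 3) ℝ).det = hs.getD 0 0 * hs.getD 3 0 * hs.getD 5 0 := by
  rw [Matrix.det_fin_three]
  simp

end Factor

/-! ### The co-norm -/

section CoNorm

variable {a b : ℕ}

/-- Entries of `M` are at most `ab` in absolute value when `t₁ = ∛(ab²)`, `t₂ = ∛(a²b)`, `a, b ≥ 1`.
[folklore] -/
theorem abs_embM_le (ha : 1 ≤ a) (hb : 1 ≤ b) (i j : Fin 3) :
    |(Matrix.of ![![1, 1, 0], ![t1 a b, -(t1 a b) / 2, Real.sqrt 3 / 2 * t1 a b],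
      ![t2 a b, -(t2 a b) / 2, -(Real.sqrt 3 / 2 * t2 a b)]] : Matrix (Fin 3) (Fin 3) ℝ) i j| ≤ (a * b : ℝ) := by
  have h1 := one_le_t1 ha hb
  have h2 := one_le_t2 ha hb
  have h1' := t1_le ha hb
  have h2' := t2_le ha hb
  have hs : Real.sqrt 3 / 2 ≤ 1 := by
    rw [div_le_one (by norm_num : (0 : ℝ) < 2)]
    have : Real.sqrt 3 < 7 / 4 := by rw [Real.sqrt_lt' (by norm_num)]; norm_num
    linarith
  have hs0 : 0 ≤ Real.sqrt 3 / 2 := by positivity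
  have hT : (1 : ℝ) ≤ a * b := h1.trans h1'
  have ha1 : |t1 a b| = t1 a b := abs_of_nonneg (zero_le_one.trans h1)
  have ha2 : |t2 a b| = t2 a b := abs_of_nonneg (zero_le_one.trans h2)
  fin_cases i <;> fin_cases j <;> simp
  · exact hT
  · exact hT
  · exact zero_le_one.trans hT
  · rw [ha1]; exact h1'
  · rw [abs_div, abs_neg, ha1, abs_two]; linarith
  · rw [abs_of_nonneg hs0, ha1]; nlinarith
  · rw [ha2]; exact h2'
  · rw [abs_div, abs_neg, ha2, abs_two]; linarith
  · rw [abs_of_nonneg hs0, ha2]; nlinarith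

/-- **The co-norm of the scaled embedding matrix**: with `|hᵢⱼ| ≤ h`, diagonal entries `≥ 1`,
`den ≥ 1`, `X > 0`, every real row `v` satisfies
`min(X⁻¹, 1) / (18 (ab)² h² den) · ‖v‖ ≤ ‖v B_X‖` (sup norms). [cite: Cohen1993, §6.5] -/
theorem embMatrix_conorm (ha : 1 ≤ a) (hb : 1 ≤ b) {den : ℕ} (hden : den ≠ 0) {X : ℝ} (hX : 0 < X)
    (hs : List ℤ) {h : ℝ} (hh : ∀ i, i < 6 → |(hs.getD i 0 : ℝ)| ≤ h)
    (h11 : 1 ≤ hs.getD 0 0) (h22 : 1 ≤ hs.getD 3 0) (h33 : 1 ≤ hs.getD 5 0) (v : Fin 3 → ℝ) :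
    min X⁻¹ 1 / (18 * (a * b : ℝ) ^ 2 * h ^ 2 * den) * ‖v‖ ≤
      ‖v ᵥ* embMatrix (t1 a b) (t2 a b) X den hs‖ := by
  set H : Matrix (Fin 3) (Fin 3) ℝ := Matrix.of ![![(hs.getD 0 0 : ℝ), hs.getD 1 0, hs.getD 2 0],
    ![0, hs.getD 3 0, hs.getD 4 0], ![0, 0, hs.getD 5 0]] with hH
  set M : Matrix (Fin 3) (Fin 3) ℝ := Matrix.of ![![1, 1, 0], ![t1 a b, -(t1 a b) / 2, Real.sqrt 3 / 2 * t1 a b],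
    ![t2 a b, -(t2 a b) / 2, -(Real.sqrt 3 / 2 * t2 a b)]] with hM
  set D : Matrix (Fin 3) (Fin 3) ℝ := Matrix.diagonal ![X⁻¹, 1, 1] with hD
  have hfac : embMatrix (t1 a b) (t2 a b) X den hs = (den : ℝ)⁻¹ • (H * M * D) :=
    embMatrix_eq_smul_mul _ _ X den hs hden hX.ne'
  -- entry bounds and positivity of `h`
  have hh0 : 1 ≤ h := by
    have := hh 0 (by norm_num)
    have h11' : (1 : ℝ) ≤ (hs.getD 0 0 : ℝ) := by exact_mod_cast h11
    exact h11'.trans ((le_abs_self _).trans this)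
  have hpos : 0 < h := one_pos.trans_le hh0
  have habpos : (0 : ℝ) < a * b := by
    have : (1 : ℝ) ≤ a * b := by exact_mod_cast Nat.one_le_iff_ne_zero.2 (by positivity)
    linarith
  -- co-norm of `H`
  have hHent : ∀ i j, |H i j| ≤ h := by
    intro i j
    fin_cases i <;> fin_cases j
    · exact hh 0 (by norm_num)
    · exact hh 1 (by norm_num)
    · exact hh 2 (by norm_num)
    · simpa [hH] using hpos.le
    · exact hh 3 (by norm_num)
    · exact hh 4 (by norm_num)
    · simpa [hH] using hpos.le
    · simpa [hH] using hpos.le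
    · exact hh 5 (by norm_num)
  have hHdet : 1 ≤ |H.det| := by
    rw [hH, det_embH]
    have h1 : (1 : ℝ) ≤ hs.getD 0 0 := by exact_mod_cast h11
    have h2 : (1 : ℝ) ≤ hs.getD 3 0 := by exact_mod_cast h22
    have h3 : (1 : ℝ) ≤ hs.getD 5 0 := by exact_mod_cast h33
    exact (one_le_mul_of_one_le_of_one_le (one_le_mul_of_one_le_of_one_le h1 h2) h3).trans (le_abs_self _)
  have hcoH : ∀ w : Fin 3 → ℝ, 1 / (6 * h ^ 2) * ‖w‖ ≤ ‖w ᵥ* H‖ := fun w =>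
    le_trans (mul_le_mul_of_nonneg_right (div_le_div_of_nonneg_right hHdet (by positivity)) (norm_nonneg _))
      (conorm_of_abs_le H hpos hHent w)
  -- co-norm of `M`
  have hMdet : 2 ≤ |M.det| := by
    rw [hM, det_embM]
    have h1 := one_le_t1 ha hb
    have h2 := one_le_t2 ha hb
    have hs3 : 3 / 2 ≤ Real.sqrt 3 := by
      rw [Real.le_sqrt (by norm_num) (by norm_num)]; norm_num
    have : (2 : ℝ) ≤ 3 * Real.sqrt 3 / 2 * t1 a b * t2 a b := by
      have ht : 1 ≤ t1 a b * t2 a b := one_le_mul_of_one_le_of_one_le h1 h2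
      nlinarith
    exact this.trans (le_abs_self _)
  have hcoM : ∀ w : Fin 3 → ℝ, 1 / (3 * (a * b : ℝ) ^ 2) * ‖w‖ ≤ ‖w ᵥ* M‖ := fun w => by
    refine le_trans (mul_le_mul_of_nonneg_right ?_ (norm_nonneg _)) (conorm_of_abs_le M habpos (abs_embM_le ha hb) w)
    rw [div_le_div_iff₀ (by positivity) (by positivity)]
    nlinarith [sq_nonneg (a * b : ℝ)]
  -- co-norm of `D`
  have hcoD : ∀ w : Fin 3 → ℝ, min X⁻¹ 1 * ‖w‖ ≤ ‖w ᵥ* D‖ := fun w =>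
    conorm_diagonal _ (le_min (inv_nonneg.2 hX.le) zero_le_one) (fun i => by
      fin_cases i
      · change min X⁻¹ 1 ≤ |X⁻¹|
        rw [abs_of_pos (inv_pos.2 hX)]; exact min_le_left _ _
      · simp
      · simp) w
  -- assemble
  have hco : ∀ w : Fin 3 → ℝ,
      1 / (6 * h ^ 2) * (1 / (3 * (a * b : ℝ) ^ 2)) * min X⁻¹ 1 * ‖w‖ ≤ ‖w ᵥ* (H * M * D)‖ := fun w =>
    conorm_mul (H * M) D (le_min (inv_nonneg.2 hX.le) zero_le_one)
      (fun u => conorm_mul H M (by positivity) hcoH hcoM u) hcoD w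
  have hfin := conorm_smul (H * M * D) ((den : ℝ)⁻¹) hco v
  rw [← hfac] at hfin
  refine le_trans (le_of_eq ?_) hfin
  have hd : (0 : ℝ) < den := by exact_mod_cast Nat.pos_of_ne_zero hden
  rw [abs_inv, abs_of_pos hd]
  field_simp
  ring

end CoNorm

/-! ### Integer rows through `B_X` -/

section Rows

variable (t₁ t₂ X : ℝ) (den : ℕ) (hs : List ℤ)

/-- **`c B_X` is the scaled embedding of the coordinate row `c H`.** [folklore] -/
theorem cast_vecMul_embMatrix (c : Fin 3 → ℤ) :
    (fun i => (c i : ℝ)) ᵥ* embMatrix t₁ t₂ X den hs =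
      embRow t₁ t₂ X den (c 0 * hs.getD 0 0) (c 0 * hs.getD 1 0 + c 1 * hs.getD 3 0)
        (c 0 * hs.getD 2 0 + c 1 * hs.getD 4 0 + c 2 * hs.getD 5 0) := by
  funext j
  fin_cases j <;>
    simp [Matrix.vecMul, dotProduct, Fin.sum_univ_three, embMatrix, embRow] <;> ring

end Rows

/-! ### The embedded row against the embeddings -/

section Values

variable {K : Type*} [Field K] [NumberField K] {a b : ℕ} {θ : K} (σ₁ : K →+* ℝ) (σ₂ : K →+* ℂ)
  (hdeg : Module.finrank ℚ K = 3) (hab : Squarefree (a * b)) (hab1 : a * b ≠ 1)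
  (hθ : θ ^ 3 = ((a * b ^ 2 : ℕ) : K)) (hσ₂ : ∃ z : K, conj (σ₂ z) ≠ σ₂ z)
include hdeg hab hab1 hθ hσ₂

/-- **The sup norm of an embedded row**: for `φ = lin (x, y, z) / den`,
`‖embRow t₁ t₂ X den x y z‖ = max (|σ₁ φ| / X) (max |Re σ₂ φ| |Im σ₂ φ|)` (`X > 0`, `den ≥ 1`).
[cite: Cohen1993, §6.5] -/
theorem norm_embRow_eq {X : ℝ} (hX : 0 < X) {den : ℕ} (hden : den ≠ 0) (x y z : ℤ) :
    ‖embRow (t1 a b) (t2 a b) X den x y z‖ =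
      max (|σ₁ (lin θ b (x, y, z) / (den : K))| / X)
        (max |(σ₂ (lin θ b (x, y, z) / (den : K))).re| |(σ₂ (lin θ b (x, y, z) / (den : K))).im|) := by
  obtain ⟨-, hb0⟩ := Literature.NumberTheory.NumberFields.PureCubic.ne_zero_of_squarefree_mul hab
  obtain ⟨ε, hε, hr⟩ := exists_sign_sigma2_lin σ₂ hdeg hab hab1 hθ hσ₂
  obtain ⟨hre, him⟩ := hr (x, y, z)
  have h1 := sigma1_lin σ₁ hθ hb0 (x, y, z)
  have hdR : (0 : ℝ) < den := by exact_mod_cast Nat.pos_of_ne_zero hden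
  have hdC : (den : ℂ) ≠ 0 := Nat.cast_ne_zero.2 hden
  have hεabs : |ε| = 1 := by rcases hε with rfl | rfl <;> norm_num
  -- the three coordinates
  have e0 : embRow (t1 a b) (t2 a b) X den x y z 0 = σ₁ (lin θ b (x, y, z) / (den : K)) / X := by
    rw [map_div₀, map_natCast, h1]
    simp [embRow]
    rw [div_div, mul_comm]
  have e1 : embRow (t1 a b) (t2 a b) X den x y z 1 = (σ₂ (lin θ b (x, y, z) / (den : K))).re := by
    rw [map_div₀, map_natCast, Complex.div_natCast_re, hre]
    simp [embRow]
  have e2 : embRow (t1 a b) (t2 a b) X den x y z 2 = ε * (σ₂ (lin θ b (x, y, z) / (den : K))).im := by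
    rw [map_div₀, map_natCast, Complex.div_natCast_im, him]
    simp only [embRow, Matrix.cons_val_two, Nat.succ_eq_add_one, Nat.reduceAdd, Matrix.tail_cons,
      Matrix.head_cons]
    have hε2 : ε * ε = 1 := by rcases hε with rfl | rfl <;> norm_num
    rw [mul_div_assoc', show ε * (ε * (Real.sqrt 3 / 2) * (↑y * t1 a b - ↑z * t2 a b)) =
      (ε * ε) * (Real.sqrt 3 / 2 * (↑y * t1 a b - ↑z * t2 a b)) by ring, hε2, one_mul]
  -- the sup norm over `Fin 3`
  have hnorm : ‖embRow (t1 a b) (t2 a b) X den x y z‖ =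
      max |embRow (t1 a b) (t2 a b) X den x y z 0| (max |embRow (t1 a b) (t2 a b) X den x y z 1|
        |embRow (t1 a b) (t2 a b) X den x y z 2|) := by
    apply le_antisymm
    · rw [pi_norm_le_iff_of_nonneg (by positivity)]
      intro i
      rw [Real.norm_eq_abs]
      fin_cases i
      · exact le_max_left _ _
      · exact (le_max_left _ _).trans (le_max_right _ _)
      · exact (le_max_right _ _).trans (le_max_right _ _)
    · refine max_le ?_ (max_le ?_ ?_) <;>
        simpa only [Real.norm_eq_abs] using norm_le_pi_norm (embRow (t1 a b) (t2 a b) X den x y z) _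
  rw [hnorm, e0, e1, e2, abs_div, abs_of_pos hX, abs_mul, hεabs, one_mul]

end Values

end PureCubicLexMin

end Literature.NumberTheory.CubicFields

end
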